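import Mathlib.Analysis.Matrix.Normed

/-!
# FrustratedLawDichotomy · residual crux `AperiodicFrustratedLawGap` (stmt-AtomisticToContinuum-27623) — THE ADJOINT CERTIFICATE LEMMA (T1, linear core)
# (hdef side, class A «coherent collar roots»: the first-order term is priced POINTWISE by force balance; decomp-a2c lens-5 g111 NODE-9; critic r1723 (D)(β))

Hypothesis (e) of the residual (single-atom minimality ⇒ force balance, tree `…NashForceBalance.ae_forceBalance_of_nash`) was idle on the
energy side.  On a coherent window the atoms are `x + L n + u n` with `|u| ≤ τ`; force balance at every interior atom reads, after flattening all
coordinates, `A *ᵥ uI + B *ᵥ uB = f` — `uI` the interior displacements (unknown), `uB` the boundary-layer displacements (only `|uB| ≤ τ` is known),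
`A`, `B` the host's force-constant blocks, `f` the anharmonic remainder (`|f| ≤ fmax`, quadratic in `τ`).  The quantity to price is a linear
functional of the displacements, `tI ⬝ᵥ uI + tB ⬝ᵥ uB` (the re-centred first-order term `T′` of the root's site energy).  A CERTIFICATE is a
vector `y` solving the adjoint system `Aᵀ *ᵥ y = tI + ρ` up to a residual `ρ`.  Then, with NO parity or symmetry hypothesis on the host:

* `dotProduct_eq_of_adjointCert` — the exact identity `tI ⬝ᵥ uI + tB ⬝ᵥ uB = (tB - Bᵀ *ᵥ y) ⬝ᵥ uB + y ⬝ᵥ f - ρ ⬝ᵥ uI`;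
* `abs_dotProduct_le_of_adjointCert` — the bound `|tI ⬝ᵥ uI + tB ⬝ᵥ uB| ≤ τ * (∑ b, |(tB - Bᵀ *ᵥ y) b| + ∑ i, |ρ i|) + (∑ i, |y i|) * fmax`;
* `abs_dotProduct_le_of_adjointCert_exact` — the residual-free, remainder-free case (`ρ = 0`, `f = 0`): `≤ τ * ∑ b, |(tB - Bᵀ *ᵥ y) b|`.

The census supplies `(A, B, tI, tB, y)` per host cell and site type (fcc, hcp, any template; pairing of sublattice sites is just another `t`), the
checker sums `∑ |tB - Bᵀ y|`; measured (lens-5 NASH53-lin and NASH53-lin2, linear model, `τ = 1/128`): the constant drops from the free value `S₁ ≈ 4.4`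
(FO `0.034`) to `0.44–1.03` at interior radius `3.5` on fcc / hcp / collar-strained members — below the collar margin.  DEF-FREE; Mathlib only.
[folklore: Lagrange-multiplier / adjoint bound for linearly constrained functionals]
-/

namespace Summit.AtomisticToContinuum.Crystallization.Theorems.FrustratedLawDichotomyAdjointCertificate

open Matrix BigOperators Finset

variable {α β : Type*} [Fintype α] [Fintype β]

/-- `|v ⬝ᵥ w| ≤ (∑ i, |v i|) * τ` when every `|w i| ≤ τ`. [folklore] -/
theorem abs_dotProduct_le_sum_abs_mul (v w : α → ℝ) {τ : ℝ} (hw : ∀ i, |w i| ≤ τ) :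
    |v ⬝ᵥ w| ≤ (∑ i, |v i|) * τ := by
  unfold dotProduct
  calc |∑ i, v i * w i| ≤ ∑ i, |v i * w i| := Finset.abs_sum_le_sum_abs _ _
    _ = ∑ i, |v i| * |w i| := by simp_rw [abs_mul]
    _ ≤ ∑ i, |v i| * τ := Finset.sum_le_sum fun i _ => mul_le_mul_of_nonneg_left (hw i) (abs_nonneg _)
    _ = (∑ i, |v i|) * τ := by rw [Finset.sum_mul]

/-- **Adjoint identity.**  Force balance `A uI + B uB = f` and an adjoint certificate `Aᵀ y = tI + ρ` rewrite the functional on the (unknown)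
interior displacements as a functional on the boundary data, the remainder and the certificate residual. [folklore] -/
theorem dotProduct_eq_of_adjointCert (A : Matrix α α ℝ) (B : Matrix α β ℝ) (tI y ρ uI f : α → ℝ) (tB uB : β → ℝ)
    (hbal : A *ᵥ uI + B *ᵥ uB = f) (hcert : Aᵀ *ᵥ y = tI + ρ) :
    tI ⬝ᵥ uI + tB ⬝ᵥ uB = (tB - Bᵀ *ᵥ y) ⬝ᵥ uB + y ⬝ᵥ f - ρ ⬝ᵥ uI := by
  have h1 : y ⬝ᵥ (A *ᵥ uI) + y ⬝ᵥ (B *ᵥ uB) = y ⬝ᵥ f := by rw [← dotProduct_add, hbal]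
  have h3 : y ⬝ᵥ (A *ᵥ uI) = (Aᵀ *ᵥ y) ⬝ᵥ uI := by rw [dotProduct_mulVec, mulVec_transpose]
  have h4 : y ⬝ᵥ (B *ᵥ uB) = (Bᵀ *ᵥ y) ⬝ᵥ uB := by rw [dotProduct_mulVec, mulVec_transpose]
  rw [h3, h4, hcert, add_dotProduct] at h1
  rw [sub_dotProduct]
  linarith

/-- ★ **Adjoint certificate bound (T1, linear core).**  With `|uI|, |uB| ≤ τ` (coherence of the window), `|f| ≤ fmax` (anharmonic remainder) and a
certificate `y` of residual `ρ`: `|tI ⬝ᵥ uI + tB ⬝ᵥ uB| ≤ τ (∑ |tB - Bᵀ y| + ∑ |ρ|) + (∑ |y|) fmax`.  No symmetry of the host is assumed. [folklore] -/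
theorem abs_dotProduct_le_of_adjointCert (A : Matrix α α ℝ) (B : Matrix α β ℝ) (tI y ρ uI f : α → ℝ) (tB uB : β → ℝ)
    {τ fmax : ℝ} (hbal : A *ᵥ uI + B *ᵥ uB = f) (hcert : Aᵀ *ᵥ y = tI + ρ)
    (huI : ∀ i, |uI i| ≤ τ) (huB : ∀ b, |uB b| ≤ τ) (hf : ∀ i, |f i| ≤ fmax) :
    |tI ⬝ᵥ uI + tB ⬝ᵥ uB| ≤ τ * (∑ b, |(tB - Bᵀ *ᵥ y) b| + ∑ i, |ρ i|) + (∑ i, |y i|) * fmax := by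
  rw [dotProduct_eq_of_adjointCert A B tI y ρ uI f tB uB hbal hcert]
  have e1 := abs_dotProduct_le_sum_abs_mul (tB - Bᵀ *ᵥ y) uB huB
  have e2 := abs_dotProduct_le_sum_abs_mul y f hf
  have e3 := abs_dotProduct_le_sum_abs_mul ρ uI huI
  calc |(tB - Bᵀ *ᵥ y) ⬝ᵥ uB + y ⬝ᵥ f - ρ ⬝ᵥ uI|
      ≤ |(tB - Bᵀ *ᵥ y) ⬝ᵥ uB| + |y ⬝ᵥ f| + |ρ ⬝ᵥ uI| := abs_sub_le_of_le_of_le' _ _ _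
    _ ≤ (∑ b, |(tB - Bᵀ *ᵥ y) b|) * τ + (∑ i, |y i|) * fmax + (∑ i, |ρ i|) * τ := by linarith
    _ = τ * (∑ b, |(tB - Bᵀ *ᵥ y) b| + ∑ i, |ρ i|) + (∑ i, |y i|) * fmax := by ring
  where
  /-- `|a + b - c| ≤ |a| + |b| + |c|` -/
  abs_sub_le_of_le_of_le' (a b c : ℝ) : |a + b - c| ≤ |a| + |b| + |c| := by
    calc |a + b - c| ≤ |a + b| + |c| := abs_sub _ _
      _ ≤ |a| + |b| + |c| := by linarith [abs_add_le a b]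

/-- The exact-certificate, harmonic case (`ρ = 0`, `f = 0`): `|tI ⬝ᵥ uI + tB ⬝ᵥ uB| ≤ τ * ∑ b, |(tB - Bᵀ *ᵥ y) b|` — the number NASH53-lin tabulates
(`τ⁻¹ ×` worst case `= ∑ |tB - Bᵀ y|`, the ℓ¹-norm of the boundary functional). [folklore] -/
theorem abs_dotProduct_le_of_adjointCert_exact (A : Matrix α α ℝ) (B : Matrix α β ℝ) (tI y uI : α → ℝ) (tB uB : β → ℝ) {τ : ℝ}
    (hbal : A *ᵥ uI + B *ᵥ uB = 0) (hcert : Aᵀ *ᵥ y = tI) (huB : ∀ b, |uB b| ≤ τ) :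
    |tI ⬝ᵥ uI + tB ⬝ᵥ uB| ≤ τ * ∑ b, |(tB - Bᵀ *ᵥ y) b| := by
  have hcert' : Aᵀ *ᵥ y = tI + 0 := by rw [add_zero]; exact hcert
  rw [dotProduct_eq_of_adjointCert A B tI y 0 uI 0 tB uB hbal hcert', dotProduct_zero, zero_dotProduct, add_zero, sub_zero, mul_comm]
  exact abs_dotProduct_le_sum_abs_mul _ _ huB

/-- **Sharpness of the exact bound**: it is attained — for the sign pattern of the boundary functional the bound is an equality, so the certified
constant `∑ |tB - Bᵀ y|` IS the worst case of the linear model (no slack hides in T1). [folklore] -/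
theorem exists_eq_of_adjointCert_exact (B : Matrix α β ℝ) (y : α → ℝ) (tB : β → ℝ) {τ : ℝ} (hτ : 0 ≤ τ) :
    ∃ uB : β → ℝ, (∀ b, |uB b| ≤ τ) ∧ (tB - Bᵀ *ᵥ y) ⬝ᵥ uB = τ * ∑ b, |(tB - Bᵀ *ᵥ y) b| := by
  set c := tB - Bᵀ *ᵥ y
  refine ⟨fun b => if 0 ≤ c b then τ else -τ, fun b => ?_, ?_⟩
  · show |(if 0 ≤ c b then τ else -τ)| ≤ τ
    by_cases h : 0 ≤ c b
    · rw [if_pos h, abs_of_nonneg hτ]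
    · rw [if_neg h, abs_neg, abs_of_nonneg hτ]
  · unfold dotProduct
    rw [Finset.mul_sum]
    refine Finset.sum_congr rfl fun b _ => ?_
    show c b * (if 0 ≤ c b then τ else -τ) = τ * |c b|
    by_cases h : 0 ≤ c b
    · rw [if_pos h, abs_of_nonneg h]; ring
    · rw [if_neg h, abs_of_neg (lt_of_not_ge h)]; ring

end Summit.AtomisticToContinuum.Crystallization.Theorems.FrustratedLawDichotomyAdjointCertificate
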